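import Summits.BirchSwinnertonDyer.BirchSwinnertonDyer.Theses.BiquadraticEisensteinDescent
import Literature.NumberTheory.EllipticCurves.Selmer
import Literature.NumberTheory.EllipticCurves.BSDSelmerCMPConverse

/-!
# Sketch — crux-ideate seat 2 g15, crux `HeegnerTwistCouplingInSupply` (stmt-BirchSwinnertonDyer-21381)
Idea `sqrt2-isogeny-heegner-pin`: the `j = 8000` corner (CM by `ℤ[√-2]`).
First-lemma signatures only (no proofs); everything over existing declarations.
-/

set_option autoImplicit false

namespace Summit.BirchSwinnertonDyer.BirchSwinnertonDyer.Cruxes.HeegnerTwistCouplingInSupply.SqrtTwoPin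

open Literature.NumberTheory.EllipticCurves

/-- The `j = 8000` family: `B_n : y² = x³ + 4n x² + 2n² x` (quadratic twist by `n` of
`B_1 : y² = x³ + 4x² + 2x`, conductor `256`, CM by `ℤ[√-2]`; `B_{-2n}` is `[√-2]`-isogenous to `B_n`). -/
def B (n : ℤ) : WeierstrassCurve ℚ := ⟨0, 4 * n, 0, 2 * n ^ 2, 0⟩

/-- PIN(3,−) for `p ≡ 5 (mod 8)` (new; mirror of the tree's `ternaryPinThreeMinus_of_mod_eight_eq_seven`):
from `p = u² + 2v² + 2w²` (`u, v, w` odd, via Legendre three squares) and a prime `ℓ ≡ 3 (8)` dividing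
`u² + 2v² ≡ 3 (8)`; `(p/ℓ) = (2w²/ℓ) = -1`, reciprocity with `p ≡ 1 (4)`. -/
def PinThreeMinusFive : Prop :=
  ∀ p : ℕ, p.Prime → p % 8 = 5 → ∃ ℓ : ℕ, ℓ.Prime ∧ ℓ < p ∧ ℓ % 8 = 3 ∧ jacobiSym (ℓ : ℤ) p = -1

/-- FIRST LEMMA of the line (elementary; ~150 lines after the tree's `exists_ternary_certificate`). -/
theorem pinThreeMinus_of_mod_eight_eq_five : PinThreeMinusFive := by
  sorry

/-- The ternary certificate behind the pin, as pure arithmetic. -/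
def TernaryCertificateFive : Prop :=
  ∀ p : ℕ, p.Prime → p % 8 = 5 →
    ∃ u v w ℓ : ℕ, u ^ 2 + 2 * v ^ 2 + 2 * w ^ 2 = p ∧ u % 2 = 1 ∧ v % 2 = 1 ∧ w % 2 = 1 ∧
      ℓ.Prime ∧ ℓ ∣ u ^ 2 + 2 * v ^ 2 ∧ ℓ % 8 = 3 ∧ ℓ < p ∧ jacobiSym (ℓ : ℤ) p = -1

/-- CELL-5 (the `[√-2]`-isogeny descent cell, hand-proved in the card, PARI 257/257 + 1833/1833):
for `m` squarefree, odd, with every prime factor `≡ ±3 (mod 8)`, `B_{-m}` has `2`-Selmer group `ℤ/2`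
(the torsion class), hence `p = 2` Selmer corank `0`. -/
def CellFive : Prop :=
  ∀ m : ℕ, Squarefree m → m % 2 = 1 → (∀ q : ℕ, q.Prime → q ∣ m → q % 8 = 3 ∨ q % 8 = 5) →
    ∀ [(B (-(m : ℤ))).IsElliptic], (B (-(m : ℤ))).selmerCorank 2 = 0

/-- CELL-15 (second cell, hand-proved in the card using `2 ± √2 ∈ (𝔽_p^×)²` for `p ≡ 15 (16)`,
PARI 936/936; the complementary class `p ≡ 7 (16)` is 0/1045): `p ≡ 15 (mod 16)`, `q₀, ℓ` primes
`≡ ±3 (8)` with `q₀ ℓ ≡ 7 (8)` and `(q₀ ℓ / p) = -1`; then `B_{-p q₀ ℓ}` has `2`-Selmer group `ℤ/2`. -/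
def CellFifteen : Prop :=
  ∀ p q₀ ℓ : ℕ, p.Prime → q₀.Prime → ℓ.Prime → p % 16 = 15 →
    (q₀ % 8 = 3 ∨ q₀ % 8 = 5) → (ℓ % 8 = 3 ∨ ℓ % 8 = 5) → (q₀ * ℓ) % 8 = 7 → q₀ ≠ ℓ →
    jacobiSym ((q₀ * ℓ : ℕ) : ℤ) p = -1 →
    ∀ [(B (-((p * q₀ * ℓ : ℕ) : ℤ))).IsElliptic], (B (-((p * q₀ * ℓ : ℕ) : ℤ))).selmerCorank 2 = 0

/-- CORNER TARGET (shape of the theorem the lead would land, cf. the tree's `cruxOnEpCornerMod24_of_facts`):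
the conclusion of crux `HeegnerTwistCouplingInSupply` for `W = B_p`, `p ≡ 5 (mod 8)`, `p ≡ ±2 (mod 5)`,
with `K = ℚ(√(-5ℓ))`, `ℓ` from `PinThreeMinusFive` — modulo named facts (descent identification AEC X.4.9,
Burungale–Tian rank-0 `2`-converse, Deuring, modularity), listed on the card. -/
def CornerTargetMod40 : Prop :=
  ∀ (p : ℕ) [Fact p.Prime] [(B p).IsElliptic] [(B p).IsGloballyMinimal] [NeZero ((B p).conductorNorm ℤ)],
    p % 8 = 5 → (p % 5 = 2 ∨ p % 5 = 3) →
    ∃ (ℓ : ℕ) (K : Type) (_ : Field K) (_ : NumberField K),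
      ℓ.Prime ∧ ℓ < p ∧ ℓ % 8 = 3 ∧ jacobiSym (ℓ : ℤ) p = -1 ∧
      IsImaginaryQuadratic K ∧ NumberField.discr K = -((5 * ℓ : ℕ) : ℤ) ∧
      4 < (NumberField.discr K).natAbs ∧
      SatisfiesHeegnerHypothesis ((B p).conductorNorm ℤ) K ∧
      ((B p).quadraticTwist (NumberField.discr K : ℚ)).entireLFunction 1 ≠ 0 ∧
      ¬ p ∣ NumberField.classNumber K

/-- Same corner for `p ≡ 15 (mod 16)`, `p ≡ ±1 (mod 5)`: here the Heegner datum `K = ℚ(√(-5ℓ))` is the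
tree's `exists_dualPin_heegnerData` verbatim; only CELL-15 is new. -/
def CornerTargetMod80 : Prop :=
  ∀ (p : ℕ) [Fact p.Prime] [(B p).IsElliptic] [(B p).IsGloballyMinimal] [NeZero ((B p).conductorNorm ℤ)],
    p % 16 = 15 → (p % 5 = 1 ∨ p % 5 = 4) →
    ∃ (ℓ : ℕ) (K : Type) (_ : Field K) (_ : NumberField K),
      ℓ.Prime ∧ ℓ < p ∧ ℓ % 8 = 3 ∧ jacobiSym (ℓ : ℤ) p = -1 ∧
      IsImaginaryQuadratic K ∧ NumberField.discr K = -((5 * ℓ : ℕ) : ℤ) ∧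
      4 < (NumberField.discr K).natAbs ∧
      SatisfiesHeegnerHypothesis ((B p).conductorNorm ℤ) K ∧
      ((B p).quadraticTwist (NumberField.discr K : ℚ)).entireLFunction 1 ≠ 0 ∧
      ¬ p ∣ NumberField.classNumber K

/-- Sanity: `2 + √2` is a square mod `p` iff `X⁴ - 4X² + 2` (min. poly. of `ζ₁₆ + ζ₁₆⁻¹`) has a root
mod `p`; for `p ≡ 15 (mod 16)` it does (Frobenius `ζ ↦ ζ⁻¹` fixes `ζ₁₆ + ζ₁₆⁻¹`). The `p`-adic step of CELL-15. -/
def TwoPlusSqrtTwoIsSquare : Prop :=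
  ∀ p : ℕ, p.Prime → p % 16 = 15 → ∃ x : ZMod p, x ^ 4 - 4 * x ^ 2 + 2 = 0

end Summit.BirchSwinnertonDyer.BirchSwinnertonDyer.Cruxes.HeegnerTwistCouplingInSupply.SqrtTwoPin
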